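import Literature.NumberTheory.Automorphic.HermitianLatticeTreeFrames            -- ★ `formCongr_mul`, `not_isModularLattice_of_isSelfDualLattice`; brings ★ Diagonal (`scaleLattice_*`) + ★ Defs (`latticeTree`, `latticeTreeIso`, `mapGL_*`)
import Literature.NumberTheory.Automorphic.UnitaryGroupFormTransport             -- ★ `conj_mem_unitaryGroupOfForm` (`T g T⁻¹ ∈ U(H)` for `g ∈ U(ᵗσ(T) H T)`)
import Summits.HodgeConjecture.HodgeConjecture.Theorems.R90S6ShellSphereDictU2    -- ★ junction letters of the `U(1,1)` tree at a datum: `valuation_map_eq_of_datum`, `isUnimodular₂_antidiagonal_two`; brings `antidiagonal_two_over_eq`, `isUniformizingElement_of_v_eq`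
import HarnessLib

/-!
# R90 · S6 — THE TYPE-SWAP ENGINE ON `X₂`: a scaling similitude `g` (`ᵗσ(g) H g = ϖ·H`) induces a graph automorphism `τ` of the lattice tree of the hermitian plane
# `(E², H)` SWAPPING self-dual ↔ `ϖ`-modular vertices and intertwining `γ ↦ γ′ = gγg⁻¹`; hence `F_i(γ′) = F_{1−i}(γ)` and `S_i(γ′, n) = S_{1−i}(γ, n)` for every `n`
# (`Theorems/R90S6TreeTypeSwapU2.lean`)

Cell `hodgecm-mathlib`, crux H413 (`stmt-HodgeConjecture-24833`), route of record `HCCMUnconditional`; programme R90-TF, section S6 (base `R90-C14`), seat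
K2E3-p28 (g4) (E3 hand lent to S6); dealer R90-C14-plan (g2) RULING B′ (R90 bus 2026-09-05T02:26:05Z): «K2E3-p28 writes the type-swap engine; R90-C14-p03 (g3)'s
HF1.2 imports it».  Helper lane `--supports stmt-HodgeConjecture-24833 --as helper`; THEOREMS ONLY (no definition, no instance, no notation, no named fact, no `sorry`):
the automorphism `τ` is delivered as an EXISTENCE theorem with its formula clauses, so no `def` is introduced.

THE MATHEMATICS ([LabesseLanglands1979] §§2–3; [Rogawski1990] §4.9 Lemma 4.9.3, §12.6; [Kottwitz1988] §2).  `X₂ = latticeTree σ ϖ H`: vertices the special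
(self-dual or `ϖ`-modular) `𝒪`-lattices of `E²`, edges `ϖM ≤ Λ ≤ M` (`M` self-dual, `Λ` `ϖ`-modular).  Let `g ∈ GL₂(E)` be a SCALING SIMILITUDE of `H`:
`ᵗσ(g)·H·g = ϖ·H` (currency of ★ `HermitianLatticeTreeTransitive` (hB); for `H = J₂ = antidiag(1,1)` and `σϖ = ϖ`: `g = diag(ϖ, 1)` — §6), `ϖ ≠ 0`, `σϖ = ϖ`.  Then
`(gM)^∨ = ϖ⁻¹·g·M^∨`, so **`τ : M ↦ g·M` (M self-dual ↦ `ϖ`-modular), `Λ ↦ ϖ⁻¹g·Λ` (Λ `ϖ`-modular ↦ self-dual)** is a bijection of the vertex set (inverse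
`N ↦ g⁻¹·ϖN ∕ N′ ↦ g⁻¹N′`) preserving adjacency (`ϖM ≤ Λ ≤ M ↦ gΛ ≤ gM ≤ ϖ⁻¹gΛ`) — A GRAPH AUTOMORPHISM SWAPPING THE TWO VERTEX TYPES — and for every
`γ ∈ U(H)` the conjugate `γ′ = gγg⁻¹` lies in `U(H)` (`U(ϖH) = U(H)`, ★ `conj_mem_unitaryGroupOfForm`) with **`τ(γ·x) = γ′·τ(x)`** (scalars commute).  Reindexing the
vertex set along `τ` (a graph isomorphism is an isometry, ★ `TreeLayers.dist_iso_apply`):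
**`#{x self-dual : d(x, γ′x) = n} = #{x ϖ-modular : d(x, γx) = n}`, `#{x ϖ-modular : d(x, γ′x) = n} = #{x self-dual : d(x, γx) = n}`** (all `n`; the fixed-point
versions `γ′x = x ↔ …` likewise), and in the type-function currency of ★ H2-NUMBERS (`c x = 0 ↔ x` self-dual): **`#{x : d(x,γ′x) = n ∧ c x = i} = #{x : d(x,γx) = n ∧ c x = j}`
(`i ≠ j`)** — the «type swap» behind the unstable (κ-) side of the rank-one fundamental lemma (Labesse–Langlands) and behind `D = 0` in the (E1) sheet (HF1.2).
* §2 `U(c·H) = U(H)`, `gγg⁻¹ ∈ U(H)`;  §3 the Gram matrix of `c·(g·h)` and the four type transfers;  §4 **`exists_typeSwap_latticeTreeIso`**;  §5 the `U(1,1)` DATUM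
  edition (`H = J₂`, `g = diag(ϖ,1) = zpowDiagGL ![1, 0]`: `hdisj` discharged by ★ `not_isModularLattice_of_isSelfDualLattice`, the similitude letter proved,
  **`exists_typeSwap_latticeTreeIso_of_datum`**).  The COUNT TRANSPORTS (reindexing along `τ`: `F_i(γ′) = F_{1−i}(γ)`, `S_i(γ′,n) = S_{1−i}(γ,n)`, predicate
  and type-function currencies) are the sequel `Theorems/R90S6TreeTypeSwapU2Transport.lean` (400-line rule).
HONEST LABEL: elementary lattice algebra ∕ graph bookkeeping over ★ carriers; proves no printed global statement, discharges no citation; count-neutral helper until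
E1.3.7.1 (LL1) ∕ E1.3.5.2.6 (HF1.2) consume it.
HC_CM is proved only modulo the 7 printed citations (2 remaining named inputs: hLiu418 = stmt-HodgeConjecture-24832, h413 = stmt-HodgeConjecture-24833) until rung 0 closes; REL ≠ ★ ≠ BUILT.

## References
* [LabesseLanglands1979] J.-P. Labesse, R. P. Langlands, *L-indistinguishability for SL(2)*, Canad. J. Math. 31 (1979): §§2–3.
* [Rogawski1990] J. D. Rogawski, *Automorphic Representations of Unitary Groups in Three Variables*, Ann. of Math. Stud. 123 (1990): §4.9 Lemma 4.9.3 pp. 54–56, §12.6.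
* [Kottwitz1988] R. E. Kottwitz, *Tamagawa numbers*, Ann. of Math. 127 (1988): §2.
* [Jacobowitz1962] R. Jacobowitz, *Hermitian forms over local fields*, Amer. J. Math. 84 (1962): §4, §7–§8.
* [Serre1980Trees] J.-P. Serre, *Trees* (1980): II.1.1.
-/

set_option autoImplicit false
-- the mandated namespace repeats the single-problem summit's segment (`HodgeConjecture.HodgeConjecture`)
set_option linter.dupNamespace false

noncomputable section

open scoped ValuativeRel Matrix MatrixGroups
open Matrix ValuativeRel SimpleGraph
open Literature.NumberTheory.Automorphic Literature.NumberTheory.Automorphic.HermitianLatticeTree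
open Literature.Combinatorics.SimpleGraph

namespace Summit.HodgeConjecture.HodgeConjecture.R90.S6

/-! ## §2 A scaling similitude normalises the unitary group: `U(c·H) = U(H)`, `gγg⁻¹ ∈ U(H)` -/

section Similitude

variable {E : Type*} [Field E] [ValuativeRel E] (σ : E →+* E) (H : Matrix (Fin 2) (Fin 2) E)

omit [ValuativeRel E] in
/-- `U(σ, c·H) = U(σ, H)` for `c ≠ 0`. [cite: Jacobowitz1962, §4] -/
theorem mem_unitaryGroupOfForm_smul_iff_two {c : E} (hc : c ≠ 0) (γ : GL (Fin 2) E) :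
    γ ∈ unitaryGroupOfForm σ (c • H) ↔ γ ∈ unitaryGroupOfForm σ H := by
  rw [mem_unitaryGroupOfForm_iff, mem_unitaryGroupOfForm_iff, Matrix.mul_smul, Matrix.smul_mul]
  exact ⟨fun h => smul_right_injective _ hc h, fun h => by rw [h]⟩

omit [ValuativeRel E] in
/-- **`γ′ = gγg⁻¹ ∈ U(H)`** for `γ ∈ U(H)` and a scaling similitude `g` (`ᵗσ(g) H g = ϖ·H`, `ϖ ≠ 0`): ★ `conj_mem_unitaryGroupOfForm` at `U(ϖ·H) = U(H)`.
[cite: Jacobowitz1962, §4] [cite: Rogawski1990, §12.6] -/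
theorem conj_similitude_mem_unitaryGroupOfForm {ϖ : E} (hϖ : ϖ ≠ 0) (g : GL (Fin 2) E) (hg : formCongr σ g H = ϖ • H)
    (γ : GL (Fin 2) E) (hγ : γ ∈ unitaryGroupOfForm σ H) : g * γ * g⁻¹ ∈ unitaryGroupOfForm σ H :=
  conj_mem_unitaryGroupOfForm σ g H (by rw [hg]; exact (mem_unitaryGroupOfForm_smul_iff_two σ H hϖ γ).2 hγ)

omit [ValuativeRel E] in
/-- The conjugate `γ′ = gγg⁻¹` of `γ ∈ U(H)` by a scaling similitude, AS AN ELEMENT of `U(H)`. [cite: Rogawski1990, §12.6] -/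
theorem exists_conj_similitude {ϖ : E} (hϖ : ϖ ≠ 0) (g : GL (Fin 2) E) (hg : formCongr σ g H = ϖ • H) (γ : unitaryGroupOfForm σ H) :
    ∃ γ' : unitaryGroupOfForm σ H, (γ' : GL (Fin 2) E) = g * (γ : GL (Fin 2) E) * g⁻¹ :=
  ⟨⟨g * (γ : GL (Fin 2) E) * g⁻¹, conj_similitude_mem_unitaryGroupOfForm σ H hϖ g hg _ γ.2⟩, rfl⟩

/-! ## §3 Gram matrices after the similitude, and the four type transfers -/

omit [ValuativeRel E] in
/-- The inverse of a scaling similitude scales by `ϖ⁻¹`: `ᵗσ(g⁻¹) H g⁻¹ = ϖ⁻¹·H`. [cite: Jacobowitz1962, §4] -/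
theorem formCongr_inv_of_similitude {ϖ : E} (hϖ : ϖ ≠ 0) (g : GL (Fin 2) E) (hg : formCongr σ g H = ϖ • H) : formCongr σ g⁻¹ H = ϖ⁻¹ • H := by
  have h1 : formCongr σ (g * g⁻¹) H = H := by
    rw [mul_inv_cancel]
    simp only [formCongr, Units.val_one, Matrix.map_one σ (map_zero σ) (map_one σ), Matrix.transpose_one, Matrix.one_mul, Matrix.mul_one]
  have h2 : formCongr σ (g * g⁻¹) H = ϖ • formCongr σ g⁻¹ H := by
    rw [HermitianLatticeTree.formCongr_mul, hg, Matrix.mul_smul, Matrix.smul_mul]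
  rw [h1] at h2
  rw [eq_inv_smul_iff₀ hϖ]
  exact h2.symm

omit [ValuativeRel E] in
/-- THE GRAM MATRIX OF `c·(g·h)`: `ᵗσ(c·gh)·H·(c·gh) = (σc·c)·ᵗσ(h)·(ᵗσ(g)Hg)·h = (σc·c·d)·ᵗσ(h)Hh` when `ᵗσ(g)Hg = d·H`. [cite: Jacobowitz1962, §4] -/
theorem gram_smul_mul_of_formCongr_eq_smul (g h : GL (Fin 2) E) {d : E} (hg : formCongr σ g H = d • H) (c : E) :
    ((c • ((g * h : GL (Fin 2) E) : Matrix (Fin 2) (Fin 2) E)).map σ)ᵀ * H * (c • ((g * h : GL (Fin 2) E) : Matrix (Fin 2) (Fin 2) E)) =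
      (σ c * c * d) • formCongr σ h H := by
  have e : ((c • ((g * h : GL (Fin 2) E) : Matrix (Fin 2) (Fin 2) E)).map σ)ᵀ * H * (c • ((g * h : GL (Fin 2) E) : Matrix (Fin 2) (Fin 2) E)) =
      (σ c * c) • formCongr σ (g * h) H := by
    rw [Matrix.map_smul' σ c _ (fun a b => map_mul σ a b), Matrix.transpose_smul, Matrix.smul_mul, Matrix.smul_mul, Matrix.mul_smul, smul_smul]
  rw [e, HermitianLatticeTree.formCongr_mul, hg, Matrix.mul_smul, Matrix.smul_mul, smul_smul]

/-- **self-dual ↦ `ϖ`-modular under `g·`**: if `M` is self-dual then `g·M` is `ϖ`-modular (`ᵗσ(gh)H(gh) = ϖ·ᵗσ(h)Hh`). [cite: Jacobowitz1962, §8] -/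
theorem isModularLattice_mapGL_of_similitude {ϖ : E} (hϖ : ϖ ≠ 0) (g : GL (Fin 2) E) (hg : formCongr σ g H = ϖ • H)
    {M : Submodule 𝒪[E] (Fin 2 → E)} (hM : IsSelfDualLattice σ H M) : IsModularLattice σ ϖ H (mapGL g M) := by
  obtain ⟨h, rfl, hu⟩ := hM
  refine ⟨g * h, mapGL_latt g h, ?_⟩
  have e := gram_smul_mul_of_formCongr_eq_smul σ H g h hg 1
  rw [one_smul, map_one, one_mul, one_mul] at e
  change IsUnimodular₂ (ϖ⁻¹ • ((((g * h : GL (Fin 2) E) : Matrix (Fin 2) (Fin 2) E).map σ)ᵀ * H * ((g * h : GL (Fin 2) E) : Matrix (Fin 2) (Fin 2) E)))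
  rw [e, inv_smul_smul₀ hϖ]
  exact hu

/-- **`ϖ`-modular ↦ self-dual under `ϖ⁻¹g·`**: if `Λ` is `ϖ`-modular then `ϖ⁻¹·g·Λ` is self-dual (`σϖ = ϖ`). [cite: Jacobowitz1962, §8] -/
theorem isSelfDualLattice_scaleLattice_inv_mapGL_of_similitude {ϖ : E} (hϖ : ϖ ≠ 0) (hσϖ : σ ϖ = ϖ) (g : GL (Fin 2) E) (hg : formCongr σ g H = ϖ • H)
    {M : Submodule 𝒪[E] (Fin 2 → E)} (hM : IsModularLattice σ ϖ H M) : IsSelfDualLattice σ H (scaleLattice ϖ⁻¹ (mapGL g M)) := by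
  obtain ⟨h, rfl, hu⟩ := hM
  rw [mapGL_latt, scaleLattice_latt]
  have hdet : (ϖ⁻¹ • ((g * h : GL (Fin 2) E) : Matrix (Fin 2) (Fin 2) E)).det ≠ 0 := by
    rw [Matrix.det_smul, Fintype.card_fin]
    exact mul_ne_zero (pow_ne_zero _ (inv_ne_zero hϖ)) (Matrix.GeneralLinearGroup.det_ne_zero _)
  refine ⟨Matrix.GeneralLinearGroup.mkOfDetNeZero _ hdet, by rw [Matrix.GeneralLinearGroup.val_mkOfDetNeZero], ?_⟩
  change IsUnimodular₂ ((((Matrix.GeneralLinearGroup.mkOfDetNeZero _ hdet : GL (Fin 2) E) : Matrix (Fin 2) (Fin 2) E).map σ)ᵀ * H *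
    ((Matrix.GeneralLinearGroup.mkOfDetNeZero _ hdet : GL (Fin 2) E) : Matrix (Fin 2) (Fin 2) E))
  rw [Matrix.GeneralLinearGroup.val_mkOfDetNeZero, gram_smul_mul_of_formCongr_eq_smul σ H g h hg ϖ⁻¹, map_inv₀, hσϖ, mul_assoc, inv_mul_cancel₀ hϖ, mul_one]
  exact hu

/-- **self-dual ↦ `ϖ`-modular under `g⁻¹·ϖ·`** (the inverse map on self-dual vertices): `g⁻¹·(ϖ·M)` is `ϖ`-modular for `M` self-dual (`σϖ = ϖ`).
[cite: Jacobowitz1962, §8] -/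
theorem isModularLattice_mapGL_inv_scaleLattice_of_similitude {ϖ : E} (hϖ : ϖ ≠ 0) (hσϖ : σ ϖ = ϖ) (g : GL (Fin 2) E) (hg : formCongr σ g H = ϖ • H)
    {M : Submodule 𝒪[E] (Fin 2 → E)} (hM : IsSelfDualLattice σ H M) : IsModularLattice σ ϖ H (mapGL g⁻¹ (scaleLattice ϖ M)) := by
  obtain ⟨h, rfl, hu⟩ := hM
  rw [mapGL_scaleLattice, mapGL_latt, scaleLattice_latt]
  have hdet : (ϖ • ((g⁻¹ * h : GL (Fin 2) E) : Matrix (Fin 2) (Fin 2) E)).det ≠ 0 := by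
    rw [Matrix.det_smul, Fintype.card_fin]
    exact mul_ne_zero (pow_ne_zero _ hϖ) (Matrix.GeneralLinearGroup.det_ne_zero _)
  refine ⟨Matrix.GeneralLinearGroup.mkOfDetNeZero _ hdet, by rw [Matrix.GeneralLinearGroup.val_mkOfDetNeZero], ?_⟩
  change IsUnimodular₂ (ϖ⁻¹ • ((((Matrix.GeneralLinearGroup.mkOfDetNeZero _ hdet : GL (Fin 2) E) : Matrix (Fin 2) (Fin 2) E).map σ)ᵀ * H *
    ((Matrix.GeneralLinearGroup.mkOfDetNeZero _ hdet : GL (Fin 2) E) : Matrix (Fin 2) (Fin 2) E)))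
  rw [Matrix.GeneralLinearGroup.val_mkOfDetNeZero, gram_smul_mul_of_formCongr_eq_smul σ H g⁻¹ h (formCongr_inv_of_similitude σ H hϖ g hg) ϖ, hσϖ,
    mul_assoc, mul_inv_cancel₀ hϖ, mul_one, inv_smul_smul₀ hϖ]
  exact hu

/-- **`ϖ`-modular ↦ self-dual under `g⁻¹·`** (the inverse map on `ϖ`-modular vertices): `g⁻¹·Λ` is self-dual for `Λ` `ϖ`-modular. [cite: Jacobowitz1962, §8] -/
theorem isSelfDualLattice_mapGL_inv_of_similitude {ϖ : E} (hϖ : ϖ ≠ 0) (g : GL (Fin 2) E) (hg : formCongr σ g H = ϖ • H)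
    {M : Submodule 𝒪[E] (Fin 2 → E)} (hM : IsModularLattice σ ϖ H M) : IsSelfDualLattice σ H (mapGL g⁻¹ M) := by
  obtain ⟨h, rfl, hu⟩ := hM
  refine ⟨g⁻¹ * h, mapGL_latt g⁻¹ h, ?_⟩
  have e := gram_smul_mul_of_formCongr_eq_smul σ H g⁻¹ h (formCongr_inv_of_similitude σ H hϖ g hg) 1
  rw [one_smul, map_one, one_mul, one_mul] at e
  change IsUnimodular₂ ((((g⁻¹ * h : GL (Fin 2) E) : Matrix (Fin 2) (Fin 2) E).map σ)ᵀ * H * ((g⁻¹ * h : GL (Fin 2) E) : Matrix (Fin 2) (Fin 2) E))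
  rw [e]
  exact hu

end Similitude

/-! ## §4 THE TYPE-SWAP AUTOMORPHISM `τ` (existence with formula clauses; no `def`) -/

section Engine

variable {E : Type*} [Field E] [ValuativeRel E] (σ : E →+* E) {ϖ : E} (H : Matrix (Fin 2) (Fin 2) E)

/-- The unitary action preserves the self-dual type (both directions). [cite: BruhatTits1972, §10] [cite: Jacobowitz1962, §7] -/
theorem isSelfDualLattice_latticeTreeIso_iff (u : unitaryGroupOfForm σ H)
    (x : {M : Submodule 𝒪[E] (Fin 2 → E) // IsSpecialLattice σ ϖ H M}) :
    IsSelfDualLattice σ H (latticeTreeIso σ ϖ H u x).1 ↔ IsSelfDualLattice σ H x.1 := by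
  constructor
  · intro h
    have h' := isSelfDualLattice_mapGL σ H _ (u⁻¹).2 h
    change IsSelfDualLattice σ H (mapGL ((u⁻¹ : unitaryGroupOfForm σ H) : GL (Fin 2) E) (mapGL (u : GL (Fin 2) E) x.1)) at h'
    rwa [← mapGL_mul, Subgroup.coe_inv, inv_mul_cancel, mapGL_one] at h'
  · intro h
    exact isSelfDualLattice_mapGL σ H _ u.2 h

/-- **THE TYPE-SWAP AUTOMORPHISM.**  `H` a form on `E²` whose self-dual and `ϖ`-modular lattices are disjoint (`hdisj`; automatic for a uniformiser, ★
`not_isModularLattice_of_isSelfDualLattice`), `ϖ ≠ 0` with `σϖ = ϖ`, and `g` a SCALING SIMILITUDE (`ᵗσ(g) H g = ϖ·H`).  THEN there is a graph automorphism `τ` of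
`latticeTree σ ϖ H` with: `τ x` self-dual ↔ `x` `ϖ`-modular; `τ x` `ϖ`-modular ↔ `x` self-dual; `(τ x).1 = g·x.1` on self-dual `x`, `= ϖ⁻¹·g·x.1` on `ϖ`-modular `x`;
and `τ (γ·x) = γ′·(τ x)` for all `γ, γ′ ∈ U(H)` with `↑γ′ = g↑γg⁻¹`. [cite: LabesseLanglands1979, §§2–3] [cite: Rogawski1990, §12.6] [cite: Serre1980Trees, II.1.1] -/
theorem exists_typeSwap_latticeTreeIso (hϖ : ϖ ≠ 0) (hσϖ : σ ϖ = ϖ)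
    (hdisj : ∀ M : Submodule 𝒪[E] (Fin 2 → E), IsSelfDualLattice σ H M → IsModularLattice σ ϖ H M → False)
    (g : GL (Fin 2) E) (hg : formCongr σ g H = ϖ • H) :
    ∃ τ : latticeTree σ ϖ H ≃g latticeTree σ ϖ H,
      (∀ x, IsSelfDualLattice σ H (τ x).1 ↔ IsModularLattice σ ϖ H x.1) ∧
      (∀ x, IsModularLattice σ ϖ H (τ x).1 ↔ IsSelfDualLattice σ H x.1) ∧
      (∀ x, IsSelfDualLattice σ H x.1 → (τ x).1 = mapGL g x.1) ∧
      (∀ x, IsModularLattice σ ϖ H x.1 → (τ x).1 = scaleLattice ϖ⁻¹ (mapGL g x.1)) ∧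
      ∀ γ γ' : unitaryGroupOfForm σ H, (γ' : GL (Fin 2) E) = g * (γ : GL (Fin 2) E) * g⁻¹ →
        ∀ x, τ (latticeTreeIso σ ϖ H γ x) = latticeTreeIso σ ϖ H γ' (τ x) := by
  classical
  -- the type dichotomy on the vertex set
  have hmod_iff : ∀ x : {M : Submodule 𝒪[E] (Fin 2 → E) // IsSpecialLattice σ ϖ H M},
      IsModularLattice σ ϖ H x.1 ↔ ¬ IsSelfDualLattice σ H x.1 :=
    fun x => ⟨fun hm hs => hdisj _ hs hm, fun hs => x.2.resolve_left hs⟩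
  -- the forward map
  have hF : ∀ x : {M : Submodule 𝒪[E] (Fin 2 → E) // IsSpecialLattice σ ϖ H M}, ∃ y : {M : Submodule 𝒪[E] (Fin 2 → E) // IsSpecialLattice σ ϖ H M},
      (IsSelfDualLattice σ H x.1 → y.1 = mapGL g x.1) ∧ (¬ IsSelfDualLattice σ H x.1 → y.1 = scaleLattice ϖ⁻¹ (mapGL g x.1)) := by
    intro x
    by_cases hx : IsSelfDualLattice σ H x.1
    · exact ⟨⟨mapGL g x.1, Or.inr (isModularLattice_mapGL_of_similitude σ H hϖ g hg hx)⟩, fun _ => rfl, fun h => absurd hx h⟩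
    · exact ⟨⟨scaleLattice ϖ⁻¹ (mapGL g x.1),
        Or.inl (isSelfDualLattice_scaleLattice_inv_mapGL_of_similitude σ H hϖ hσϖ g hg ((hmod_iff x).2 hx))⟩, fun h => absurd h hx, fun _ => rfl⟩
  choose F hFsd hFmd using hF
  -- the backward map
  have hB : ∀ y : {M : Submodule 𝒪[E] (Fin 2 → E) // IsSpecialLattice σ ϖ H M}, ∃ x : {M : Submodule 𝒪[E] (Fin 2 → E) // IsSpecialLattice σ ϖ H M},
      (IsSelfDualLattice σ H y.1 → x.1 = mapGL g⁻¹ (scaleLattice ϖ y.1)) ∧ (¬ IsSelfDualLattice σ H y.1 → x.1 = mapGL g⁻¹ y.1) := by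
    intro y
    by_cases hy : IsSelfDualLattice σ H y.1
    · exact ⟨⟨mapGL g⁻¹ (scaleLattice ϖ y.1), Or.inr (isModularLattice_mapGL_inv_scaleLattice_of_similitude σ H hϖ hσϖ g hg hy)⟩,
        fun _ => rfl, fun h => absurd hy h⟩
    · exact ⟨⟨mapGL g⁻¹ y.1, Or.inl (isSelfDualLattice_mapGL_inv_of_similitude σ H hϖ g hg ((hmod_iff y).2 hy))⟩, fun h => absurd h hy, fun _ => rfl⟩
  choose B hBsd hBmd using hB
  -- the types of the images
  have hFtype : ∀ x, IsSelfDualLattice σ H (F x).1 ↔ ¬ IsSelfDualLattice σ H x.1 := by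
    intro x
    by_cases hx : IsSelfDualLattice σ H x.1
    · refine ⟨fun h => (hdisj _ h ?_).elim, fun h => absurd hx h⟩
      rw [hFsd x hx]
      exact isModularLattice_mapGL_of_similitude σ H hϖ g hg hx
    · refine ⟨fun _ => hx, fun _ => ?_⟩
      rw [hFmd x hx]
      exact isSelfDualLattice_scaleLattice_inv_mapGL_of_similitude σ H hϖ hσϖ g hg ((hmod_iff x).2 hx)
  have hBtype : ∀ y, IsSelfDualLattice σ H (B y).1 ↔ ¬ IsSelfDualLattice σ H y.1 := by
    intro y
    by_cases hy : IsSelfDualLattice σ H y.1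
    · refine ⟨fun h => (hdisj _ h ?_).elim, fun h => absurd hy h⟩
      rw [hBsd y hy]
      exact isModularLattice_mapGL_inv_scaleLattice_of_similitude σ H hϖ hσϖ g hg hy
    · refine ⟨fun _ => hy, fun _ => ?_⟩
      rw [hBmd y hy]
      exact isSelfDualLattice_mapGL_inv_of_similitude σ H hϖ g hg ((hmod_iff y).2 hy)
  -- mutually inverse
  have hBF : ∀ x, B (F x) = x := by
    intro x
    apply Subtype.ext
    by_cases hx : IsSelfDualLattice σ H x.1
    · have h1 : ¬ IsSelfDualLattice σ H (F x).1 := fun h => (hFtype x).1 h hx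
      rw [hBmd (F x) h1, hFsd x hx, ← mapGL_mul, inv_mul_cancel, mapGL_one]
    · have h1 : IsSelfDualLattice σ H (F x).1 := (hFtype x).2 hx
      rw [hBsd (F x) h1, hFmd x hx, scaleLattice_scaleLattice, mul_inv_cancel₀ hϖ, scaleLattice_one, ← mapGL_mul, inv_mul_cancel, mapGL_one]
  have hFB : ∀ y, F (B y) = y := by
    intro y
    apply Subtype.ext
    by_cases hy : IsSelfDualLattice σ H y.1
    · have h1 : ¬ IsSelfDualLattice σ H (B y).1 := fun h => (hBtype y).1 h hy
      rw [hFmd (B y) h1, hBsd y hy, ← mapGL_mul, mul_inv_cancel, mapGL_one, scaleLattice_scaleLattice, inv_mul_cancel₀ hϖ, scaleLattice_one]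
    · have h1 : IsSelfDualLattice σ H (B y).1 := (hBtype y).2 hy
      rw [hFsd (B y) h1, hBmd y hy, ← mapGL_mul, mul_inv_cancel, mapGL_one]
  have hFinj : ∀ v w, F v = F w → v = w := fun v w h => by rw [← hBF v, h, hBF]
  -- adjacency is preserved
  have hadj : ∀ v w, (latticeTree σ ϖ H).Adj (F v) (F w) ↔ (latticeTree σ ϖ H).Adj v w := by
    intro v w
    rw [latticeTree_adj_iff, latticeTree_adj_iff]
    by_cases hv : IsSelfDualLattice σ H v.1 <;> by_cases hw : IsSelfDualLattice σ H w.1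
    · -- both self-dual: no edge on either side
      have hv' : ¬ IsSelfDualLattice σ H (F v).1 := fun h => (hFtype v).1 h hv
      have hw' : ¬ IsSelfDualLattice σ H (F w).1 := fun h => (hFtype w).1 h hw
      constructor
      · rintro ⟨-, ⟨h1, -, -, -⟩ | ⟨h1, -, -, -⟩⟩
        · exact absurd h1 hv'
        · exact absurd h1 hw'
      · rintro ⟨-, ⟨-, h2, -, -⟩ | ⟨-, h2, -, -⟩⟩
        · exact (hdisj _ hw h2).elim
        · exact (hdisj _ hv h2).elim
    · -- `v` self-dual, `w` `ϖ`-modular: the edge `ϖv ≤ w ≤ v` ↦ `g w ≤ g v ≤ ϖ⁻¹ g w`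
      have hv' : ¬ IsSelfDualLattice σ H (F v).1 := fun h => (hFtype v).1 h hv
      have hw' : IsSelfDualLattice σ H (F w).1 := (hFtype w).2 hw
      have e1 : scaleLattice ϖ (F w).1 ≤ (F v).1 ↔ w.1 ≤ v.1 := by
        rw [hFmd w hw, hFsd v hv, scaleLattice_scaleLattice, mul_inv_cancel₀ hϖ, scaleLattice_one, mapGL_le_mapGL_iff]
      have e2 : (F v).1 ≤ (F w).1 ↔ scaleLattice ϖ v.1 ≤ w.1 := by
        rw [hFmd w hw, hFsd v hv, ← scaleLattice_le_iff_le_scaleLattice_inv hϖ, ← mapGL_scaleLattice, mapGL_le_mapGL_iff]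
      constructor
      · rintro ⟨h0, ⟨h1, -, -, -⟩ | ⟨-, -, h3, h4⟩⟩
        · exact absurd h1 hv'
        · exact ⟨fun h => h0 (by rw [h]), Or.inl ⟨hv, (hmod_iff w).2 hw, e2.1 h4, e1.1 h3⟩⟩
      · rintro ⟨h0, ⟨-, -, h3, h4⟩ | ⟨h1, -, -, -⟩⟩
        · exact ⟨fun h => h0 (hFinj v w h), Or.inr ⟨hw', (hmod_iff (F v)).2 hv', e1.2 h4, e2.2 h3⟩⟩
        · exact absurd h1 hw
    · -- `v` `ϖ`-modular, `w` self-dual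
      have hv' : IsSelfDualLattice σ H (F v).1 := (hFtype v).2 hv
      have hw' : ¬ IsSelfDualLattice σ H (F w).1 := fun h => (hFtype w).1 h hw
      have e1 : scaleLattice ϖ (F v).1 ≤ (F w).1 ↔ v.1 ≤ w.1 := by
        rw [hFmd v hv, hFsd w hw, scaleLattice_scaleLattice, mul_inv_cancel₀ hϖ, scaleLattice_one, mapGL_le_mapGL_iff]
      have e2 : (F w).1 ≤ (F v).1 ↔ scaleLattice ϖ w.1 ≤ v.1 := by
        rw [hFmd v hv, hFsd w hw, ← scaleLattice_le_iff_le_scaleLattice_inv hϖ, ← mapGL_scaleLattice, mapGL_le_mapGL_iff]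
      constructor
      · rintro ⟨h0, ⟨-, -, h3, h4⟩ | ⟨h1, -, -, -⟩⟩
        · exact ⟨fun h => h0 (by rw [h]), Or.inr ⟨hw, (hmod_iff v).2 hv, e2.1 h4, e1.1 h3⟩⟩
        · exact absurd h1 hw'
      · rintro ⟨h0, ⟨h1, -, -, -⟩ | ⟨-, -, h3, h4⟩⟩
        · exact absurd h1 hv
        · exact ⟨fun h => h0 (hFinj v w h), Or.inl ⟨hv', (hmod_iff (F w)).2 hw', e1.2 h4, e2.2 h3⟩⟩
    · -- both `ϖ`-modular: no edge on either side
      have hv' : IsSelfDualLattice σ H (F v).1 := (hFtype v).2 hv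
      have hw' : IsSelfDualLattice σ H (F w).1 := (hFtype w).2 hw
      constructor
      · rintro ⟨-, ⟨-, h2, -, -⟩ | ⟨-, h2, -, -⟩⟩
        · exact (hdisj _ hw' h2).elim
        · exact (hdisj _ hv' h2).elim
      · rintro ⟨-, ⟨h1, -, -, -⟩ | ⟨h1, -, -, -⟩⟩
        · exact absurd h1 hv
        · exact absurd h1 hw
  -- the automorphism
  let τ : latticeTree σ ϖ H ≃g latticeTree σ ϖ H :=
    { toFun := F, invFun := B, left_inv := hBF, right_inv := hFB, map_rel_iff' := fun {v w} => hadj v w }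
  refine ⟨τ, fun x => ?_, fun x => ?_, fun x hx => hFsd x hx, fun x hx => hFmd x ((hmod_iff x).1 hx), fun γ γ' hγ' x => ?_⟩
  · show IsSelfDualLattice σ H (F x).1 ↔ _
    rw [hFtype, hmod_iff]
  · show IsModularLattice σ ϖ H (F x).1 ↔ _
    rw [hmod_iff, hFtype, not_not]
  · show F (latticeTreeIso σ ϖ H γ x) = latticeTreeIso σ ϖ H γ' (F x)
    apply Subtype.ext
    change (F (latticeTreeIso σ ϖ H γ x)).1 = mapGL (γ' : GL (Fin 2) E) (F x).1
    by_cases hx : IsSelfDualLattice σ H x.1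
    · rw [hFsd _ ((isSelfDualLattice_latticeTreeIso_iff σ H γ x).2 hx), hFsd x hx]
      change mapGL g (mapGL (γ : GL (Fin 2) E) x.1) = _
      rw [← mapGL_mul, ← mapGL_mul, hγ', inv_mul_cancel_right]
    · rw [hFmd _ (fun h => hx ((isSelfDualLattice_latticeTreeIso_iff σ H γ x).1 h)), hFmd x hx]
      change scaleLattice ϖ⁻¹ (mapGL g (mapGL (γ : GL (Fin 2) E) x.1)) = _
      rw [mapGL_scaleLattice, ← mapGL_mul, ← mapGL_mul, hγ', inv_mul_cancel_right]

end Engine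


/-! ## §5 The `U(1,1)` datum letters: `hdisj` discharged, and `g = diag(ϖ, 1)` IS a scaling similitude of `J₂ = antidiag(1,1)` -/

section Datum

variable {K : Type} [Field K] [Valued K (WithZero (Multiplicative ℤ))] [ValuativeRel K]
  [(Valued.v : Valuation K (WithZero (Multiplicative ℤ))).Compatible] {σ : K →+* K} {ϖ : K}

/-- **`hdisj` AT A DATUM**: for an unramified local conjugation datum `(σ, ϖ)` no lattice is both self-dual and `ϖ`-modular, for ANY form `H`
(★ `not_isModularLattice_of_isSelfDualLattice` ∘ ★ `valuation_map_eq_of_datum` ∘ ★ `isUniformizingElement_of_v_eq`). [cite: Jacobowitz1962, §8] -/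
theorem not_isModularLattice_of_isSelfDualLattice_of_datum (hd : HermitianLattice.UnramifiedLocalConjDatum σ ϖ) (H : Matrix (Fin 2) (Fin 2) K)
    (M : Submodule 𝒪[K] (Fin 2 → K)) (h1 : IsSelfDualLattice σ H M) (h2 : IsModularLattice σ ϖ H M) : False :=
  not_isModularLattice_of_isSelfDualLattice σ (valuation_map_eq_of_datum hd) (isUniformizingElement_of_v_eq hd.vϖ) H h1 h2

omit [ValuativeRel K] [(Valued.v : Valuation K (WithZero (Multiplicative ℤ))).Compatible] in
/-- **`diag(ϖ, 1)` IS A SCALING SIMILITUDE OF `J₂`**: `ᵗσ(diag(ϖ,1))·antidiag(1,1)·diag(ϖ,1) = ϖ·antidiag(1,1)` (`σϖ = ϖ`), with `diag(ϖ,1) = zpowDiagGL ![1, 0]`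
(★ `coe_zpowDiagGL_two`, ★ `antidiagonal_two_over_eq`). [cite: Rogawski1990, §12.6] [cite: Jacobowitz1962, §8] -/
theorem formCongr_zpowDiagGL_one_zero_antidiagonal_two (hd : HermitianLattice.UnramifiedLocalConjDatum σ ϖ) :
    formCongr σ (zpowDiagGL (CartanUnique.uniformizer_ne_zero hd.vϖ) ![(1 : ℤ), 0]) ((StdForm.antidiagonal 2).over K) =
      ϖ • (StdForm.antidiagonal 2).over K := by
  change (((zpowDiagGL (CartanUnique.uniformizer_ne_zero hd.vϖ) ![(1 : ℤ), 0] : GL (Fin 2) K) : Matrix (Fin 2) (Fin 2) K).map σ)ᵀ *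
      (StdForm.antidiagonal 2).over K * ((zpowDiagGL (CartanUnique.uniformizer_ne_zero hd.vϖ) ![(1 : ℤ), 0] : GL (Fin 2) K) : Matrix (Fin 2) (Fin 2) K) = _
  rw [coe_zpowDiagGL_two, UnitaryGroup.Two.antidiagonal_two_over_eq]
  ext i j
  fin_cases i <;> fin_cases j <;> simp [Matrix.mul_apply, Fin.sum_univ_two, hd.σϖ]

/-- **THE TYPE-SWAP AUTOMORPHISM OF `X₂(K)` AT A DATUM** (`H = J₂`, `g = diag(ϖ,1)`): §4 with `hdisj` and the similitude letter DISCHARGED.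
[cite: LabesseLanglands1979, §§2–3] [cite: Rogawski1990, §12.6] [cite: Serre1980Trees, II.1.1] -/
theorem exists_typeSwap_latticeTreeIso_of_datum (hd : HermitianLattice.UnramifiedLocalConjDatum σ ϖ) :
    ∃ τ : latticeTree σ ϖ ((StdForm.antidiagonal 2).over K) ≃g latticeTree σ ϖ ((StdForm.antidiagonal 2).over K),
      (∀ x, IsSelfDualLattice σ ((StdForm.antidiagonal 2).over K) (τ x).1 ↔ IsModularLattice σ ϖ ((StdForm.antidiagonal 2).over K) x.1) ∧
      (∀ x, IsModularLattice σ ϖ ((StdForm.antidiagonal 2).over K) (τ x).1 ↔ IsSelfDualLattice σ ((StdForm.antidiagonal 2).over K) x.1) ∧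
      (∀ x, IsSelfDualLattice σ ((StdForm.antidiagonal 2).over K) x.1 →
        (τ x).1 = mapGL (zpowDiagGL (CartanUnique.uniformizer_ne_zero hd.vϖ) ![(1 : ℤ), 0]) x.1) ∧
      (∀ x, IsModularLattice σ ϖ ((StdForm.antidiagonal 2).over K) x.1 →
        (τ x).1 = scaleLattice ϖ⁻¹ (mapGL (zpowDiagGL (CartanUnique.uniformizer_ne_zero hd.vϖ) ![(1 : ℤ), 0]) x.1)) ∧
      ∀ γ γ' : unitaryGroupOfForm σ ((StdForm.antidiagonal 2).over K),
        (γ' : GL (Fin 2) K) = zpowDiagGL (CartanUnique.uniformizer_ne_zero hd.vϖ) ![(1 : ℤ), 0] * (γ : GL (Fin 2) K) *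
          (zpowDiagGL (CartanUnique.uniformizer_ne_zero hd.vϖ) ![(1 : ℤ), 0])⁻¹ →
        ∀ x, τ (latticeTreeIso σ ϖ ((StdForm.antidiagonal 2).over K) γ x) = latticeTreeIso σ ϖ ((StdForm.antidiagonal 2).over K) γ' (τ x) :=
  exists_typeSwap_latticeTreeIso σ ((StdForm.antidiagonal 2).over K) (CartanUnique.uniformizer_ne_zero hd.vϖ) hd.σϖ
    (fun M h1 h2 => not_isModularLattice_of_isSelfDualLattice_of_datum hd _ M h1 h2) _ (formCongr_zpowDiagGL_one_zero_antidiagonal_two hd)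

end Datum

end Summit.HodgeConjecture.HodgeConjecture.R90.S6

end
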